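import Mathlib
import HarnessLib

/-!
# Route `TautLoopKelvin`, crux `TautLoopLaw` (stmt-NavierStokesRegularity-15249), line
  `Sketch-ideas-r1k1` (Dini–Saks architecture) — tools stub `stub_tautLoopStepOpProductTools`

**First-order expansion of an ordered product of near-identity operators.** In a normed ring
with `‖1‖ ≤ 1` (here the algebra of bounded operators on `ℝ³` with the operator norm), if
`‖xₖ‖ ≤ α` for `k < n` then the ordered product `Pₙ = (1 + x₀) ⋯ (1 + xₙ₋₁)` satisfies

  `‖Pₙ − 1 − Σₖ xₖ‖ ≤ (1 + α)ⁿ − 1 − n α ≤ (n α)² e^{n α}`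

(induction on `n` through `Pₙ₊₁ − 1 − Σ x = (P' − 1 − Σ' x) + x₀ (P' − 1)`, then
`(1 + α)ⁿ ≤ e^{nα}` and `eʸ − 1 − y ≤ y² eʸ` for `y ≥ 0`). Specialised to `xₖ = τ Bₖ + Eₖ`,
`‖Bₖ‖ ≤ β`, `‖Eₖ‖ ≤ ε`, `α = τβ + ε`, this gives

  `‖Πₖ (1 + τ Bₖ + Eₖ) − (1 + τ Σₖ Bₖ)‖ ≤ e^{n(τβ+ε)} ((n(τβ+ε))² + n ε)`.

Everything is folklore.
-/

open Finset Real

namespace Summit.NavierStokesRegularity.NavierStokesRegularity.Theorems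

set_option linter.dupNamespace false

/-! ## The normed-ring induction -/

/-- In a normed ring with `‖1‖ ≤ 1`, if `‖xₖ‖ ≤ α` (`0 ≤ α`) for all `k < n`, then the ordered
product `P = Πₖ (1 + xₖ)` satisfies `‖P‖ ≤ (1+α)ⁿ`, `‖P − 1‖ ≤ (1+α)ⁿ − 1` and
`‖P − 1 − Σₖ xₖ‖ ≤ (1+α)ⁿ − 1 − nα`. [folklore] -/
theorem tautLoopOpProd_norm_prod_le {R : Type*} [NormedRing R] (h1 : ‖(1 : R)‖ ≤ 1)
    {α : ℝ} (hα : 0 ≤ α) (n : ℕ) :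
    ∀ x : Fin n → R, (∀ k, ‖x k‖ ≤ α) →
      ‖(List.ofFn fun k => 1 + x k).prod‖ ≤ (1 + α) ^ n ∧
      ‖(List.ofFn fun k => 1 + x k).prod - 1‖ ≤ (1 + α) ^ n - 1 ∧
      ‖(List.ofFn fun k => 1 + x k).prod - 1 - ∑ k, x k‖ ≤ (1 + α) ^ n - 1 - n * α := by
  induction n with
  | zero =>
    intro x _
    refine ⟨by simpa using h1, by simp, by simp⟩
  | succ n ih =>
    intro x hx
    obtain ⟨hP, hP1, hP2⟩ := ih (fun k => x k.succ) (fun k => hx k.succ)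
    rw [List.ofFn_succ, List.prod_cons, Fin.sum_univ_succ]
    set P := (List.ofFn fun k : Fin n => 1 + x k.succ).prod with hPdef
    have n1 : ‖x 0 * P‖ ≤ α * (1 + α) ^ n :=
      (norm_mul_le _ _).trans (mul_le_mul (hx 0) hP (norm_nonneg _) hα)
    have n2 : ‖x 0 * (P - 1)‖ ≤ α * ((1 + α) ^ n - 1) :=
      (norm_mul_le _ _).trans (mul_le_mul (hx 0) hP1 (norm_nonneg _) hα)
    have e1 : (1 + x 0) * P = P + x 0 * P := by rw [add_mul, one_mul]
    have e2 : (1 + x 0) * P - 1 = (P - 1) + x 0 * P := by rw [add_mul, one_mul]; abel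
    have e3 : (1 + x 0) * P - 1 - (x 0 + ∑ k : Fin n, x k.succ)
        = (P - 1 - ∑ k : Fin n, x k.succ) + x 0 * (P - 1) := by
      rw [add_mul, one_mul, mul_sub, mul_one]; abel
    refine ⟨?_, ?_, ?_⟩
    · rw [e1]
      calc ‖P + x 0 * P‖ ≤ ‖P‖ + ‖x 0 * P‖ := norm_add_le _ _
        _ ≤ (1 + α) ^ n + α * (1 + α) ^ n := add_le_add hP n1
        _ = (1 + α) ^ (n + 1) := by ring
    · rw [e2]
      calc ‖P - 1 + x 0 * P‖ ≤ ‖P - 1‖ + ‖x 0 * P‖ := norm_add_le _ _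
        _ ≤ ((1 + α) ^ n - 1) + α * (1 + α) ^ n := add_le_add hP1 n1
        _ = (1 + α) ^ (n + 1) - 1 := by ring
    · rw [e3]
      push_cast
      calc ‖P - 1 - ∑ k : Fin n, x k.succ + x 0 * (P - 1)‖
          ≤ ‖P - 1 - ∑ k : Fin n, x k.succ‖ + ‖x 0 * (P - 1)‖ := norm_add_le _ _
        _ ≤ ((1 + α) ^ n - 1 - n * α) + α * ((1 + α) ^ n - 1) := add_le_add hP2 n2
        _ = (1 + α) ^ (n + 1) - 1 - (n + 1) * α := by ring

/-! ## The scalar fact -/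

/-- `(1 + α)ⁿ − 1 − nα ≤ (nα)² e^{nα}` for `α ≥ 0`: combine `(1 + α)ⁿ ≤ e^{nα}` with
`eʸ − 1 − y ≤ y² eʸ` for `y = nα ≥ 0` (the latter from `1 − y ≤ e^{−y}`). [folklore] -/
theorem tautLoopOpProd_pow_sub_le {α : ℝ} (hα : 0 ≤ α) (n : ℕ) :
    (1 + α) ^ n - 1 - n * α ≤ (n * α) ^ 2 * Real.exp (n * α) := by
  have hpow : (1 + α) ^ n ≤ Real.exp (n * α) := by
    rw [Real.exp_nat_mul]
    exact pow_le_pow_left₀ (by linarith) (by linarith [Real.add_one_le_exp α]) n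
  -- the scalar fact `eʸ − 1 − y ≤ y² eʸ` at `y = nα`
  set y : ℝ := n * α with hy_def
  have hy : 0 ≤ y := by positivity
  have h : Real.exp y - 1 ≤ y * Real.exp y := by
    have h1 : (-y + 1) * Real.exp y ≤ Real.exp (-y) * Real.exp y :=
      mul_le_mul_of_nonneg_right (Real.add_one_le_exp (-y)) (Real.exp_pos y).le
    rw [← Real.exp_add, neg_add_cancel, Real.exp_zero] at h1
    linarith
  nlinarith [mul_le_mul_of_nonneg_left h hy]

/-! ## The registered tools stub -/

/-- **Product of near-identity operators, first-order expansion.** For bounded operators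
`Bₖ, Eₖ` on `ℝ³` with `‖Bₖ‖ ≤ β`, `‖Eₖ‖ ≤ ε` and `τ, β, ε ≥ 0`,
`‖Πₖ (1 + τBₖ + Eₖ) − (1 + τ Σₖ Bₖ)‖ ≤ e^{n(τβ+ε)} ((n(τβ+ε))² + nε)` (ordered product).
[folklore] -/
theorem stub_tautLoopStepOpProductTools : ∀ (n : ℕ) (τ β ε : ℝ)
    (B E : Fin n → (EuclideanSpace ℝ (Fin 3) →L[ℝ] EuclideanSpace ℝ (Fin 3))),
    0 ≤ τ → 0 ≤ β → 0 ≤ ε → (∀ k, ‖B k‖ ≤ β) → (∀ k, ‖E k‖ ≤ ε) →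
    ‖(List.ofFn (fun k : Fin n => ContinuousLinearMap.id ℝ (EuclideanSpace ℝ (Fin 3))
        + τ • B k + E k)).prod
      - (ContinuousLinearMap.id ℝ (EuclideanSpace ℝ (Fin 3)) + τ • ∑ k : Fin n, B k)‖
      ≤ Real.exp (n * (τ * β + ε)) * ((n * (τ * β + ε)) ^ 2 + n * ε) := by
  intro n τ β ε B E hτ hβ hε hB hE
  have h1 : ‖(1 : EuclideanSpace ℝ (Fin 3) →L[ℝ] EuclideanSpace ℝ (Fin 3))‖ ≤ 1 :=
    ContinuousLinearMap.norm_id_le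
  set α : ℝ := τ * β + ε with hα_def
  have hα : 0 ≤ α := by positivity
  set x : Fin n → (EuclideanSpace ℝ (Fin 3) →L[ℝ] EuclideanSpace ℝ (Fin 3)) :=
    fun k => τ • B k + E k with hx_def
  have hx : ∀ k, ‖x k‖ ≤ α := fun k =>
    (norm_add_le _ _).trans (add_le_add
      (by rw [norm_smul, Real.norm_of_nonneg hτ]; exact mul_le_mul_of_nonneg_left (hB k) hτ)
      (hE k))
  obtain ⟨-, -, hP⟩ := tautLoopOpProd_norm_prod_le h1 hα n x hx
  have hlist : (List.ofFn fun k : Fin n =>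
      ContinuousLinearMap.id ℝ (EuclideanSpace ℝ (Fin 3)) + τ • B k + E k)
        = List.ofFn fun k => 1 + x k := by
    congr 1
    funext k
    rw [add_assoc]
    rfl
  have hsum : ∑ k, x k = τ • ∑ k, B k + ∑ k, E k := by
    simp only [hx_def, Finset.sum_add_distrib, Finset.smul_sum]
  have hEsum : ‖∑ k, E k‖ ≤ n * ε := by
    calc ‖∑ k, E k‖ ≤ ∑ k, ‖E k‖ := norm_sum_le _ _
      _ ≤ ∑ _k : Fin n, ε := Finset.sum_le_sum fun k _ => hE k
      _ = n * ε := by simp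
  have key : (List.ofFn fun k => 1 + x k).prod
        - (ContinuousLinearMap.id ℝ (EuclideanSpace ℝ (Fin 3)) + τ • ∑ k : Fin n, B k)
      = ((List.ofFn fun k => 1 + x k).prod - 1 - ∑ k, x k) + ∑ k, E k := by
    rw [hsum, ← ContinuousLinearMap.one_def]
    abel
  rw [hlist, key]
  calc ‖((List.ofFn fun k => 1 + x k).prod - 1 - ∑ k, x k) + ∑ k, E k‖
      ≤ ‖(List.ofFn fun k => 1 + x k).prod - 1 - ∑ k, x k‖ + ‖∑ k, E k‖ := norm_add_le _ _
    _ ≤ ((1 + α) ^ n - 1 - n * α) + n * ε := add_le_add hP hEsum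
    _ ≤ (n * α) ^ 2 * Real.exp (n * α) + n * ε := by
      gcongr
      exact tautLoopOpProd_pow_sub_le hα n
    _ ≤ Real.exp (n * α) * ((n * α) ^ 2 + n * ε) := by
      nlinarith [mul_nonneg (by positivity : (0 : ℝ) ≤ n * ε)
        (sub_nonneg.2 (Real.one_le_exp (by positivity : (0 : ℝ) ≤ n * α)))]

end Summit.NavierStokesRegularity.NavierStokesRegularity.Theorems
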